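import Summits.KontsevichZagierPeriods.KontsevichZagierPeriods.Theorems.HurwitzMicroSectorsNormalFormPrincipleDilogExistsBoxAtoms
import Literature.NumberTheory.Transcendental.KZProductIdeal

/-!
# `NormalFormPrinciple` (stmt-KontsevichZagierPeriods-3869), line `SketchIdeator1` —
# M3 kernel capstone: the two reference boxes with their values, and the carrier of family 7

Pure proof file (registered sub-goal `m3k_exists_refs`, lead seat c9; `--supports` the crux).
The kernel capstone of the layer `M3` shows that Conjecture 1 of Kontsevich–Zagier holds on the
subgroup of `KZ.FormalRep` generated by the eleven dimension-three box families of the six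
equal-value instances, conditionally on the `ℚ`-linear independence of `ζ(3)` and `π² log 2`:
every generator reduces, after doubling, to `α•Z + β•Q` modulo `KZ.relations`, and the assembly
then EVALUATES. This file supplies the three representations the assembly starts from, as honest
integral representations of the Kontsevich–Zagier calculus
(`Literature.NumberTheory.Transcendental.KZ.IntegralRep 3`) on the open unit box `□³ = (0,1)³`:

* the `ζ(3)` box `Z = [□³, 1/(1 − x₀x₁x₂)]` together with its VALUE `Z.value = ζ(3) = zetaValue 3`
  (the tree's `box_integral_one_div_one_sub_mul_three`: expand the geometric series and integrate
  term-wise);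
* the `ζ(2) log 2` box `Q = [□³, 1/((1 − x₀x₁)(1 + x₂))]` together with its VALUE
  `Q.value = π²/6 · log 2`, realised as the PRODUCT representation (`KZ.IntegralRep.prod`, the
  "Fubini formula" of Kontsevich–Zagier §4.1) of Beukers' `ζ(2)` box `[□², 1/(1 − x₀x₁)]`
  (value `π²/6`, `box_integral_one_div_one_sub_mul_two`) with the logarithm interval
  `[(0,1), 1/(1 + x₀)]` (value `∫₀¹ dx/(1 + x) = log 2`); its domain `□² × (0,1)` is `□³`, its
  integrand is the product function (`KZ.IntegralRep.prod_integrand_eq`), and its value is the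
  product of the values (`KZ.IntegralRep.value_prod`);
* a box carrier `N7 = [□³, 1/((1 + x₀)(1 + x₀x₁x₂))]` of family 7 (bounded continuous integrand on
  a bounded box).

Semialgebraicity of the integrands is `isSemialgebraicFunOn_aeval_div_aeval` (quotients of
`ℚ`-polynomials with non-vanishing denominators); the box is `KZ.isSemialgebraic_box`.

Sources: M. Kontsevich, D. Zagier, *Periods* (2001), §1.1 (`ζ(2)`, `ζ(3)`, `log 2` as periods),
§1.2, §4.1 (Fubini); F. Beukers, *A note on the irrationality of ζ(2) and ζ(3)*, Bull. LMS 11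
(1979). No definitions are introduced.
-/

noncomputable section

open MeasureTheory Set
open Literature.NumberTheory.Transcendental Literature.NumberTheory.Transcendental.KZ
open Literature.ModelTheory.ExponentialFields (IsSemialgebraic)

namespace Summit.KontsevichZagierPeriods.HurwitzMicroSectors.NormalFormPrinciple.PiBox.M3

/-! ## Elementary facts on the open unit box -/

/-- On the open unit box of `ℝ³` the product of the coordinates is `< 1`. [folklore] -/
private theorem m3a_prod_lt_one {x : Fin 3 → ℝ} (hx : ∀ i, x i ∈ Set.Ioo (0:ℝ) 1) :
    x 0 * x 1 * x 2 < 1 :=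
  mul_lt_one_of_nonneg_of_lt_one_left (mul_nonneg (hx 0).1.le (hx 1).1.le)
    (mul_lt_one_of_nonneg_of_lt_one_left (hx 0).1.le (hx 0).2 (hx 1).2.le) (hx 2).2.le

/-! ## The logarithm interval `[(0,1), 1/(1 + x₀)]` and its value `log 2` -/

/-- **`∫₀¹ dx/(1 + x) = log 2`**, written over the open unit box of `ℝ¹` (Lebesgue measure
restricted to the box is the one-fold product of Lebesgue measure restricted to `(0,1)`,
`Beukers.volume_restrict_cube`; Fubini for a one-fold product, `integral_fin_nat_prod_eq_prod`;
then the translation `x ↦ 1 + x` and `∫₁² dx/x = log 2`). [cite: KontsevichZagier2001, §1.1] -/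
private theorem m3a_setIntegral_box_one_div_one_add :
    ∫ x in {x : Fin 1 → ℝ | ∀ i, x i ∈ Set.Ioo (0:ℝ) 1}, 1 / (1 + x 0) = Real.log 2 := by
  rw [Beukers.volume_restrict_cube 1]
  have h1 := integral_fin_nat_prod_eq_prod (n := 1) (𝕜 := ℝ)
    (μ := fun _ : Fin 1 => (volume : Measure ℝ).restrict (Set.Ioo (0:ℝ) 1))
    (fun (_ : Fin 1) (t : ℝ) => 1 / (1 + t))
  simp only [Fin.prod_univ_one] at h1
  rw [h1, ← integral_Ioc_eq_integral_Ioo, ← intervalIntegral.integral_of_le zero_le_one]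
  have h2 := intervalIntegral.integral_comp_add_left (fun t : ℝ => 1 / t) (a := 0) (b := 1) (1:ℝ)
  simp only [add_zero, one_add_one_eq_two] at h2
  rw [h2, integral_one_div_of_pos one_pos two_pos, div_one]

/-- **The logarithm interval exists and represents `log 2`.** `[(0,1), 1/(1 + x₀)]` is an integral
representation of dimension `1` (rational integrand with denominator `≥ 1`, bounded and continuous
on the compact interval `[0,1]`), of value `log 2`. [cite: KontsevichZagier2001, §1.1] -/
private theorem m3a_exists_logBox :
    ∃ L : IntegralRep 1, L.domain = {x | ∀ i, x i ∈ Set.Ioo (0:ℝ) 1} ∧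
      (L.integrand = fun x => 1 / (1 + x 0)) ∧ L.value = Real.log 2 := by
  have hB := isSemialgebraic_box 1
  have hsa : IsSemialgebraicFunOn ℚ {x : Fin 1 → ℝ | ∀ i, x i ∈ Set.Ioo (0:ℝ) 1}
      (fun x => 1 / (1 + x 0)) := by
    refine (isSemialgebraicFunOn_aeval_div_aeval hB (1 : MvPolynomial (Fin 1) ℚ)
      (1 + MvPolynomial.X 0) fun x hx => ?_).congr fun x _ => ?_
    · simp only [map_add, map_one, MvPolynomial.aeval_X]
      have h0 := (hx 0).1
      positivity
    · simp only [map_add, map_one, MvPolynomial.aeval_X]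
  have hint : IntegrableOn (fun x : Fin 1 → ℝ => 1 / (1 + x 0))
      {x : Fin 1 → ℝ | ∀ i, x i ∈ Set.Ioo (0:ℝ) 1} := by
    have hc : ContinuousOn (fun x : Fin 1 → ℝ => 1 / (1 + x 0)) (Set.Icc 0 1) :=
      continuousOn_const.div (by fun_prop) fun x hx => by
        have h0 : (0:ℝ) ≤ x 0 := hx.1 0
        positivity
    exact (hc.integrableOn_compact isCompact_Icc).mono_set
      fun x hx => ⟨fun i => (hx i).1.le, fun i => (hx i).2.le⟩
  refine ⟨⟨_, _, hB, hsa, hint⟩, rfl, rfl, ?_⟩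
  rw [IntegralRep.value]
  exact m3a_setIntegral_box_one_div_one_add

/-! ## The `ζ(2)` and `ζ(3)` boxes with their values -/

/-- **Beukers' `ζ(2)` box with its value.** `[□², 1/(1 − x₀x₁)]` exists (the dilogarithm box
`D(1)` of the layer `Dilog`) and represents `∫∫_{(0,1)²} dx₀dx₁/(1 − x₀x₁) = π²/6`.
[cite: KontsevichZagier2001, §1.1] -/
private theorem m3a_exists_zetaTwoBox :
    ∃ B : IntegralRep 2, B.domain = {x | ∀ i, x i ∈ Set.Ioo (0:ℝ) 1} ∧
      (B.integrand = fun x => 1 / (1 - x 0 * x 1)) ∧ B.value = Real.pi ^ 2 / 6 := by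
  obtain ⟨B, hBd, hBi⟩ := Dilog.exists_dilogBox isAlgebraic_one (Or.inl le_rfl)
  refine ⟨B, hBd, hBi, ?_⟩
  rw [IntegralRep.value, hBd, hBi]
  exact box_integral_one_div_one_sub_mul_two.2

/-- **The `ζ(3)` box with its value.** `Z = [□³, 1/(1 − x₀x₁x₂)]` exists (a quotient of
`ℚ`-polynomials with denominator `1 − x₀x₁x₂ > 0` on the box, absolutely integrable there) and
represents `∫∫∫_{(0,1)³} dx/(1 − x₀x₁x₂) = ζ(3) = zetaValue 3`.
[cite: KontsevichZagier2001, §1.1] -/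
private theorem m3a_exists_zetaThreeBox :
    ∃ Z : IntegralRep 3, Z.domain = {x | ∀ i, x i ∈ Set.Ioo (0:ℝ) 1} ∧
      (Z.integrand = fun x => 1 / (1 - x 0 * x 1 * x 2)) ∧ Z.value = zetaValue 3 := by
  have hB := isSemialgebraic_box 3
  have hsa : IsSemialgebraicFunOn ℚ {x : Fin 3 → ℝ | ∀ i, x i ∈ Set.Ioo (0:ℝ) 1}
      (fun x => 1 / (1 - x 0 * x 1 * x 2)) := by
    refine (isSemialgebraicFunOn_aeval_div_aeval hB (1 : MvPolynomial (Fin 3) ℚ)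
      (1 - MvPolynomial.X 0 * MvPolynomial.X 1 * MvPolynomial.X 2) fun x hx => ?_).congr
      fun x _ => ?_
    · simp only [map_sub, map_one, map_mul, MvPolynomial.aeval_X]
      exact (sub_pos.2 (m3a_prod_lt_one hx)).ne'
    · simp only [map_sub, map_one, map_mul, MvPolynomial.aeval_X]
  refine ⟨⟨_, _, hB, hsa, box_integral_one_div_one_sub_mul_three.1⟩, rfl, rfl, ?_⟩
  rw [IntegralRep.value]
  exact box_integral_one_div_one_sub_mul_three.2

/-! ## The `ζ(2) log 2` box as a product representation -/

/-- **The `ζ(2) log 2` box with its value.** The product representation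
`Q = [□², 1/(1 − x₀x₁)] · [(0,1), 1/(1 + x₀)]` (Kontsevich–Zagier's Fubini product,
`KZ.IntegralRep.prod`) has domain `□² × (0,1) = □³`, integrand `1/((1 − x₀x₁)(1 + x₂))` on it
(`KZ.IntegralRep.prod_integrand_eq`), and value `π²/6 · log 2` (`KZ.IntegralRep.value_prod`).
[cite: KontsevichZagier2001, §4.1] -/
private theorem m3a_exists_zetaTwoLogTwoBox :
    ∃ Q : IntegralRep 3, Q.domain = {x | ∀ i, x i ∈ Set.Ioo (0:ℝ) 1} ∧
      EqOn Q.integrand (fun x => 1 / ((1 - x 0 * x 1) * (1 + x 2))) Q.domain ∧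
      Q.value = Real.pi ^ 2 / 6 * Real.log 2 := by
  obtain ⟨B, hBd, hBi, hBv⟩ := m3a_exists_zetaTwoBox
  obtain ⟨L, hLd, hLi, hLv⟩ := m3a_exists_logBox
  have hd : (B.prod L).domain = {x : Fin 3 → ℝ | ∀ i, x i ∈ Set.Ioo (0:ℝ) 1} := by
    ext z
    rw [IntegralRep.prod_domain B L, IntegralRep.mem_prodDomain B L, hBd, hLd]
    simp only [mem_setOf_eq, Fin.forall_fin_two, Fin.forall_fin_one]
    constructor
    · rintro ⟨⟨h0, h1⟩, h2⟩ i
      fin_cases i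
      exacts [h0, h1, h2]
    · intro h
      exact ⟨⟨h _, h _⟩, h _⟩
  refine ⟨B.prod L, hd, fun z _ => ?_, ?_⟩
  · rw [IntegralRep.prod_integrand_eq B L, IntegralRep.prodFun_apply B L, hBi, hLi]
    show 1 / (1 - z 0 * z 1) * (1 / (1 + z 2)) = 1 / ((1 - z 0 * z 1) * (1 + z 2))
    rw [one_div_mul_one_div]
  · rw [IntegralRep.value_prod B L, hBv, hLv]

/-! ## The carrier of family 7 -/

/-- **The box carrier of family 7 exists.** `N7 = [□³, 1/((1 + x₀)(1 + x₀x₁x₂))]` is an integral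
representation: a quotient of `ℚ`-polynomials whose denominator is `≥ 1` on the box, bounded and
continuous on the compact cube `[0,1]³`, hence absolutely integrable on `□³`.
[cite: KontsevichZagier2001, §1.1] -/
private theorem m3a_exists_halfPointBox :
    ∃ N7 : IntegralRep 3, N7.domain = {x | ∀ i, x i ∈ Set.Ioo (0:ℝ) 1} ∧
      (N7.integrand = fun x => 1 / ((1 + x 0) * (1 + x 0 * x 1 * x 2))) := by
  have hB := isSemialgebraic_box 3
  have hsa : IsSemialgebraicFunOn ℚ {x : Fin 3 → ℝ | ∀ i, x i ∈ Set.Ioo (0:ℝ) 1}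
      (fun x => 1 / ((1 + x 0) * (1 + x 0 * x 1 * x 2))) := by
    refine (isSemialgebraicFunOn_aeval_div_aeval hB (1 : MvPolynomial (Fin 3) ℚ)
      ((1 + MvPolynomial.X 0) * (1 + MvPolynomial.X 0 * MvPolynomial.X 1 * MvPolynomial.X 2))
      fun x hx => ?_).congr fun x _ => ?_
    · simp only [map_add, map_one, map_mul, MvPolynomial.aeval_X]
      have h0 := (hx 0).1
      have h1 := (hx 1).1
      have h2 := (hx 2).1
      positivity
    · simp only [map_add, map_one, map_mul, MvPolynomial.aeval_X]
  have hint : IntegrableOn (fun x : Fin 3 → ℝ => 1 / ((1 + x 0) * (1 + x 0 * x 1 * x 2)))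
      {x : Fin 3 → ℝ | ∀ i, x i ∈ Set.Ioo (0:ℝ) 1} := by
    have hc : ContinuousOn (fun x : Fin 3 → ℝ => 1 / ((1 + x 0) * (1 + x 0 * x 1 * x 2)))
        (Set.Icc 0 1) :=
      continuousOn_const.div (by fun_prop) fun x hx => by
        have h0 : (0:ℝ) ≤ x 0 := hx.1 0
        have h1 : (0:ℝ) ≤ x 1 := hx.1 1
        have h2 : (0:ℝ) ≤ x 2 := hx.1 2
        positivity
    exact (hc.integrableOn_compact isCompact_Icc).mono_set
      fun x hx => ⟨fun i => (hx i).1.le, fun i => (hx i).2.le⟩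
  exact ⟨⟨_, _, hB, hsa, hint⟩, rfl, rfl⟩

/-! ## The registered sub-goal -/

/-- **Stub K1 (`m3k_exists_refs`; registered sub-goal of stmt-KontsevichZagierPeriods-3869, line
`SketchIdeator1`, layer `M3` kernel capstone).** The two reference representations of the kernel
capstone with their VALUES, and a box carrier of family 7: the `ζ(3)` box
`Z = [(0,1)³, 1/(1 − x₀x₁x₂)]` with `Z.value = zetaValue 3`; a representation `Q` on `(0,1)³` whose
integrand agrees there with `1/((1 − x₀x₁)(1 + x₂))`, with `Q.value = π²/6 · log 2` (the Fubini
product of Beukers' `ζ(2)` box and the logarithm interval `∫₀¹ dx/(1 + x) = log 2`); and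
`N7 = [(0,1)³, 1/((1 + x₀)(1 + x₀x₁x₂))]`. [cite: KontsevichZagier2001, §1.1] -/
theorem m3k_exists_refs :
    ∃ (Z Q N7 : IntegralRep 3),
      (Z.domain = {x | ∀ i, x i ∈ Set.Ioo (0:ℝ) 1} ∧ (Z.integrand = fun x => 1 / (1 - x 0 * x 1 * x 2)) ∧
        Z.value = zetaValue 3) ∧
      (Q.domain = {x | ∀ i, x i ∈ Set.Ioo (0:ℝ) 1} ∧
        EqOn Q.integrand (fun x => 1 / ((1 - x 0 * x 1) * (1 + x 2))) Q.domain ∧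
        Q.value = Real.pi ^ 2 / 6 * Real.log 2) ∧
      (N7.domain = {x | ∀ i, x i ∈ Set.Ioo (0:ℝ) 1} ∧ (N7.integrand = fun x => 1 / ((1 + x 0) * (1 + x 0 * x 1 * x 2)))) := by
  obtain ⟨Z, hZ⟩ := m3a_exists_zetaThreeBox
  obtain ⟨Q, hQ⟩ := m3a_exists_zetaTwoLogTwoBox
  obtain ⟨N7, hN7⟩ := m3a_exists_halfPointBox
  exact ⟨Z, Q, N7, hZ, hQ, hN7⟩

end Summit.KontsevichZagierPeriods.HurwitzMicroSectors.NormalFormPrinciple.PiBox.M3
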